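import Summits.QuantumFields.BalabanUV.Beta.FP.PerfectPropagatorKernelLegs
import Literature.MathematicalPhysics.QuantumFieldTheory.Balaban1983to89.Beta.OneStepResolventKernel

/-!
# `BalabanUV.Beta.FP.PerfectPolarization` — road «FP» for binder row D1, leaf H2, row **H2V-0** (owner ruling R-FP-23, `HOME/b2b-balaban-beta-d1-p3/H2V-DESIGN.md`
# f78878bd5f8d2d18 §1): THE OBJECT `PiBF` — the BF-Feynman one-loop polarization kernel of the unit-lattice perfect theory, TYPED OVER ABSTRACT VERTEX DATA in the
# tree's `ExpKernelCalculus.hessKer` shape, with the perfect propagator `Re PinfKer` as the gluon leg and `latticeGreen/2` as the ghost leg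

HONEST DEPENDENCY (page 1, mandatory): continuum YM on T⁴ ⇐ BetaPertH ∧ nine spine estimates (0/9 proved); BetaPertH ⇐ (D1) ∧ (D4) ∧
CAP+tail; G-an2-4 gates asym, D1 and NE2/3/4.  HONEST FRAMING (cell contract, verbatim): «discharging `BetaPertH` makes Bałaban's UV
stability UNCONDITIONAL — a real constructive-QFT result; it is NOT the continuum limit and NOT the Clay problem.»  THIS MODULE is a DEFINITION file:
three [our object] data definitions (`Pker`, `G0ker`, `PiBF`) and their `rfl`-level bookkeeping (field-block formula, multiplier blocks vanish, translation
invariance of the legs, linearity of `PiBF` in the colour weights).  It proves NO estimate, fixes NO colour weight (they are PARAMETERS `wg wgh`, pinned by row H2-ASM-4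
against an3's dictionary), asserts NOTHING about the perfect action's jets (row H2V-4), and is NOT `hgerm`, NOT D1, NOT BetaPertH, NOT continuum, NOT Clay.
No `def … : Prop`, nothing cited, 0 sorry.

ABSOLUTE RULE (cell charter, verbatim): «No internally-minted statement may enter as a cited fact. Every hypothesis is either kernel-proved in this
package or a verbatim quotation of a PUBLISHED theorem with page reference. The manuscript(s) under audit are NOT citable for their own disputed
steps — they are the thing under adjudication; programme-internal (2001/route/tribunal) claims are never citable.»

WHY (H2V-DESIGN §0–§1).  In the H′ bookkeeping of road FP (`FP/HorizontalTailAssemblyDefect`, p238191) the slope of `f(n)` is read off the window of ONE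
n-independent fine kernel `K`: the one-loop polarization of the perfect unit-lattice theory in background-field Feynman gauge.  Its legs are explicit
(`FP/PerfectPropagatorKernel`: `PinfKer`, (K0)–(K3)); its vertices are the jets of the perfect action — NOT explicit, but exponentially localised, exactly
gauge-covariant, Bose-symmetric and reflection covariant, which by `FP/CubicGermExchange.cubicGermOf_eq_ymGerm_of_(bond)Letters` ALONE fixes their cubic germ.  Hence
the H2 END is proved for EVERY admissible vertex family, and the object is typed over abstract data:
  `PiBF wg wgh V W v w μ ν z := wg · hessKer Pker V W μ ν z − wgh · hessKer G0ker v w μ ν z`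
(`hessKer A V W μ ν z = ½·tadpole A (W μ 0 ν z) − ½·bubble A (V μ 0) (V ν z)`, `Literature…ExpKernelCalculus`), where `V`∕`W` are the TOTAL cubic family ∕ quartic table of the
gluon sector (perfect action jets + BF slice jets, packed fibre `Fib 3`, colour stripped in the `ad(t_c)`-coefficient convention of `StepJetData` §5) and `v`∕`w` the ghost
sector's (scalar fibre `Unit`).  Road FP's `K` is `PiBF wg wgh (S∞³ + sliceV3) (S∞⁴ + sliceW4) gh3 gh4` (rows H2V-2∕3∕4); the END (rows H2-ASM-1…5) never needs `S∞³` evaluated.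

CONTENT: §1 `Pker` (the field block `(x,z,inl α,inl β) ↦ Re PinfKer α β (z − x)` at `d + 1 = 4`, zero on multiplier blocks), `Pker_inl_inl`, `Pker_inl_inr`∕`_inr_inl`∕`_inr_inr`,
`Pker_translate`; §2 `G0ker` (scalar fibre, `(x,z) ↦ latticeGreen (z − x)/2` — the ghost leg of `FP/ConstrainedGhost`, `SquareTable.gFree`'s normalisation), `G0ker_apply`,
`G0ker_translate`; §3 `PiBF`, `PiBF_def`, `PiBF_zero_zero`, `PiBF_add_weights` (linearity in the weights).
Provenance: road FP OWNER b2b-balaban-beta-d1-p3 gen 6 (prover-b2b-balaban-beta-d1-p3-g6-0), 2026-08-20, row H2V-0.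
-/

noncomputable section

namespace Summit.QuantumFields.BalabanUV.Beta.FP.PerfectPolarization

open Literature.MathematicalPhysics.QuantumFieldTheory.Balaban1983to89
open Literature.MathematicalPhysics.QuantumFieldTheory.Balaban1983to89.Beta
open Literature.Probability.LatticeModels (latticeGreen)
open ExpKernelCalculus (MKer Site hessKer shiftK)
open OneStepResolventKernel (Fib)
open Summit.QuantumFields.BalabanUV.Beta.FP.PerfectPropagatorKernel (PinfKer)

/-! ## §1 The gluon leg: the field block of the unconstrained perfect propagator -/

/-- [our object] **THE GLUON LEG `Pker`**: the packed-fibre kernel on `ℤ⁴` whose field–field block is the real part of the unconstrained perfect BF-Feynman propagator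
`Re PinfKer α β (z − x)` (`FP/PerfectPropagatorKernel`, lattice dimension `3 + 1`) and whose blocks touching a multiplier leg vanish (the unconstrained theory has no
multiplier field).  A definition asserting nothing. -/
def Pker : MKer 4 (Fib 3) := fun x z a b =>
  match a, b with
  | Sum.inl α, Sum.inl β => (PinfKer (d := 3) α β (z - x)).re
  | Sum.inl _, Sum.inr _ => 0
  | Sum.inr _, Sum.inl _ => 0
  | Sum.inr _, Sum.inr _ => 0

/-- [our object] the field block of `Pker`. -/
@[simp] theorem Pker_inl_inl (x z : Site 4) (α β : Fin 4) : Pker x z (Sum.inl α) (Sum.inl β) = (PinfKer (d := 3) α β (z - x)).re := rfl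

/-- [our object] the field–multiplier block of `Pker` vanishes. -/
@[simp] theorem Pker_inl_inr (x z : Site 4) (α β : Fin 4) : Pker x z (Sum.inl α) (Sum.inr β) = 0 := rfl

/-- [our object] the multiplier–field block of `Pker` vanishes. -/
@[simp] theorem Pker_inr_inl (x z : Site 4) (α β : Fin 4) : Pker x z (Sum.inr α) (Sum.inl β) = 0 := rfl

/-- [our object] the multiplier block of `Pker` vanishes. -/
@[simp] theorem Pker_inr_inr (x z : Site 4) (α β : Fin 4) : Pker x z (Sum.inr α) (Sum.inr β) = 0 := rfl

/-- [our object] `Pker` is translation invariant: `Pker (x + v) (z + v) = Pker x z`, i.e. `shiftK v Pker = Pker`. -/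
theorem Pker_translate (v : Site 4) : shiftK v Pker = Pker := by
  funext x z a b
  show Pker (x + v) (z + v) a b = Pker x z a b
  rcases a with α | α <;> rcases b with β | β
  · show (PinfKer (d := 3) α β (z + v - (x + v))).re = (PinfKer (d := 3) α β (z - x)).re
    rw [add_sub_add_right_eq_sub]
  · rfl
  · rfl
  · rfl

/-! ## §2 The ghost leg: the free scalar Green's function in the `/2` normalisation -/

/-- [our object] **THE GHOST LEG `G0ker`**: the scalar-fibre kernel `(x, z) ↦ latticeGreen (z − x)/2` on `ℤ⁴` (the free leg of `FP/ConstrainedGhost.Gs_eq_free_add_ghostRem` and of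
an3's `SquareTable.gFree`).  A definition asserting nothing. -/
def G0ker : MKer 4 Unit := fun x z _ _ => latticeGreen (z - x) / 2

/-- [our object] the entries of `G0ker`. -/
@[simp] theorem G0ker_apply (x z : Site 4) (a b : Unit) : G0ker x z a b = latticeGreen (z - x) / 2 := rfl

/-- [our object] `G0ker` is translation invariant. -/
theorem G0ker_translate (v : Site 4) : shiftK v G0ker = G0ker := by
  funext x z a b
  show G0ker (x + v) (z + v) a b = G0ker x z a b
  simp only [G0ker_apply, add_sub_add_right_eq_sub]

/-! ## §3 The polarization kernel over abstract vertex data -/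

/-- [our object] **THE BF PERFECT POLARIZATION KERNEL OVER ABSTRACT VERTEX DATA** (H2V-DESIGN §1):
`PiBF wg wgh V W v w μ ν z := wg · hessKer Pker V W μ ν z − wgh · hessKer G0ker v w μ ν z` — gluon sector (total cubic family `V`, quartic table `W` on the packed fibre) with
colour weight `wg`, minus the ghost sector (cubic family `v`, quartic table `w` on the scalar fibre) with weight `wgh`.  The weights are PARAMETERS (row H2-ASM-4 pins them
against `FP/BubbleGermValue.germ_hval`); nothing is asserted. -/
def PiBF (wg wgh : ℝ) (V : Fin 4 → Site 4 → MKer 4 (Fib 3)) (W : Fin 4 → Site 4 → Fin 4 → Site 4 → MKer 4 (Fib 3))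
    (v : Fin 4 → Site 4 → MKer 4 Unit) (w : Fin 4 → Site 4 → Fin 4 → Site 4 → MKer 4 Unit) : Fin 4 → Fin 4 → Site 4 → ℝ :=
  fun μ ν z => wg * hessKer Pker V W μ ν z - wgh * hessKer G0ker v w μ ν z

/-- [our object] the defining formula of `PiBF`. -/
theorem PiBF_def (wg wgh : ℝ) (V : Fin 4 → Site 4 → MKer 4 (Fib 3)) (W : Fin 4 → Site 4 → Fin 4 → Site 4 → MKer 4 (Fib 3))
    (v : Fin 4 → Site 4 → MKer 4 Unit) (w : Fin 4 → Site 4 → Fin 4 → Site 4 → MKer 4 Unit) (μ ν : Fin 4) (z : Site 4) :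
    PiBF wg wgh V W v w μ ν z = wg * hessKer Pker V W μ ν z - wgh * hessKer G0ker v w μ ν z := rfl

/-- [our object] with both colour weights zero the kernel vanishes. -/
theorem PiBF_zero_zero (V : Fin 4 → Site 4 → MKer 4 (Fib 3)) (W : Fin 4 → Site 4 → Fin 4 → Site 4 → MKer 4 (Fib 3))
    (v : Fin 4 → Site 4 → MKer 4 Unit) (w : Fin 4 → Site 4 → Fin 4 → Site 4 → MKer 4 Unit) (μ ν : Fin 4) (z : Site 4) :
    PiBF 0 0 V W v w μ ν z = 0 := by
  simp only [PiBF_def, zero_mul, sub_zero]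

/-- [our object] `PiBF` is additive in the pair of colour weights (the gluon and ghost sectors enter linearly). -/
theorem PiBF_add_weights (wg wg' wgh wgh' : ℝ) (V : Fin 4 → Site 4 → MKer 4 (Fib 3)) (W : Fin 4 → Site 4 → Fin 4 → Site 4 → MKer 4 (Fib 3))
    (v : Fin 4 → Site 4 → MKer 4 Unit) (w : Fin 4 → Site 4 → Fin 4 → Site 4 → MKer 4 Unit) (μ ν : Fin 4) (z : Site 4) :
    PiBF (wg + wg') (wgh + wgh') V W v w μ ν z = PiBF wg wgh V W v w μ ν z + PiBF wg' wgh' V W v w μ ν z := by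
  simp only [PiBF_def]
  ring

/-- [our object] the gluon sector alone: `PiBF wg 0 V W v w = wg · hessKer Pker V W`. -/
theorem PiBF_gluon (wg : ℝ) (V : Fin 4 → Site 4 → MKer 4 (Fib 3)) (W : Fin 4 → Site 4 → Fin 4 → Site 4 → MKer 4 (Fib 3))
    (v : Fin 4 → Site 4 → MKer 4 Unit) (w : Fin 4 → Site 4 → Fin 4 → Site 4 → MKer 4 Unit) (μ ν : Fin 4) (z : Site 4) :
    PiBF wg 0 V W v w μ ν z = wg * hessKer Pker V W μ ν z := by
  simp only [PiBF_def, zero_mul, sub_zero]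

/-- [our object] the ghost sector alone: `PiBF 0 wgh V W v w = −wgh · hessKer G0ker v w`. -/
theorem PiBF_ghost (wgh : ℝ) (V : Fin 4 → Site 4 → MKer 4 (Fib 3)) (W : Fin 4 → Site 4 → Fin 4 → Site 4 → MKer 4 (Fib 3))
    (v : Fin 4 → Site 4 → MKer 4 Unit) (w : Fin 4 → Site 4 → Fin 4 → Site 4 → MKer 4 Unit) (μ ν : Fin 4) (z : Site 4) :
    PiBF 0 wgh V W v w μ ν z = -(wgh * hessKer G0ker v w μ ν z) := by
  simp only [PiBF_def, zero_mul, zero_sub]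

end Summit.QuantumFields.BalabanUV.Beta.FP.PerfectPolarization

end
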